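/-
Copyright (c) 2026 the pub-hodgecm-mathlib formalisation cell (harness21).  Prover seat hodgecm-mathlib-K2E3-p17 (g9), Track B «K2-LIT» / h413
(`stmt-HodgeConjecture-24833`), line `K2_E3_EllipticInputs`, leaf (nsc-S-A'), D120 brick IRR''-c2 «Kill», part (K-d): no `{X²}`-piece.  2026-09-04.
-/
import Summits.HodgeConjecture.HodgeConjecture.Theorems.K2E3GL3OneLinkNestedHighKill          -- (K-c) (this seat): `false_of_constituent_X_two`
import Summits.HodgeConjecture.HodgeConjecture.Theorems.K2E3GL3OneLinkNestedHighConstituent   -- ★ IRR″-b2 (this seat's lineage): `exists_constituent_X_two`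
import Summits.HodgeConjecture.HodgeConjecture.Theorems.K2E3DegenerateSubquotientHeredity      -- ★ HER: `forall_mk_whittakerTwist_eq_zero_subquotient`, `forall_mk_charTwist_eq_zero_of_surjective`
import Literature.NumberTheory.Automorphic.IrreducibleClassesConstituents                             -- ★ `IrrClass.IsConstituentOf.of_injective ∕ of_surjective`, `IrrClass.mk_eq_mk_iff`
import HarnessLib

/-!
# Crux `H413` — leaf (nsc-S-A′), brick IRR″-c2 (K-d): A SMOOTH `V` WITH `E(V) = {X²}` INSIDE A REPRESENTATION CARRYING THE CELL HYPOTHESIS DOES NOT EXIST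

Cell `hodgecm-mathlib`, Track B; THEOREMS ONLY; count-neutral helper (`--supports stmt-HodgeConjecture-24833 --as helper`).  Letters as in ★ IRR″-a∕-b∕-b2∕-c1 and (K-c):
`X = tch(ην½⁻¹, ην½, ην½)`.  **`false_of_piece_X_two`**: let `I` be smooth with the cell hypothesis at `c = ![0,0,1]` (★ E4a's binder `h3cell` specialised; paid by ★ (CELL-3)),
`V` a smooth non-zero subquotient of `I` (`ι₁` injective, `π₁` surjective) with finite-dimensional `r_B V`, all of whose constituents have `r_B ≠ 0` (`hJ`), `ψ`-degenerate, with
`mult V X = 2` and no other weight.  Then `False`: ★ IRR″-b2 `exists_constituent_X_two` gives an irreducible constituent `ω` with `E(ω) = {X²}`; a constituent of `V` is a constituent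
of `I` (★ `IsConstituentOf.of_surjective ∕ of_injective`), i.e. a subquotient `N₁ ⁄ N₂` of `I` up to isomorphism (★ `IrrClass.mk_eq_mk_iff`); `ψ`-degeneracy descends to `ω`
(★ HER); and (K-c) `false_of_constituent_X_two` kills `ω`.  Consumers: IRR″ head `K2E3GL3OneLinkNestedHighIrreducible` (V = a piece of `D″`, I = I(X) via ★ STD-EMB) and
K2E3-p03's IRR‴ head (V = a piece of `D‴`, I = I(Y) via ★ STD-EMB′).

HONEST LABEL: HC_CM is proved only modulo the 7 printed citations (2 remaining named inputs: hLiu418 = stmt-HodgeConjecture-24832, h413 =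
stmt-HodgeConjecture-24833) until rung 0 closes; count-neutral helper.

## References
* [BernsteinZelevinsky1977] I. N. Bernstein, A. V. Zelevinsky, *Induced representations of reductive p-adic groups I*, Ann. Sci. ÉNS 10 (1977), Prop. 1.9, Cor. 2.13, Thm. 2.9, Thm. 4.7.
* [Zelevinsky1980] A. V. Zelevinsky, *Induced representations of reductive p-adic groups II*, Ann. Sci. ÉNS 13 (1980), §1.6, Ex. 3.2, 4.3.
-/

set_option autoImplicit false
-- the mandated namespace repeats `HodgeConjecture.HodgeConjecture`, as in every `Theorems/*.lean` of this sub-problem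
set_option linter.dupNamespace false

noncomputable section

open Module Representation Function Literature.NumberTheory.Automorphic Literature.NumberTheory.Automorphic.Zelevinsky1980
open Literature.NumberTheory.GaloisRepresentations.IsNonarchimedeanLocalField Literature.RepresentationTheory.FiniteGroups Literature.RepresentationTheory.Semisimple
open scoped MatrixGroups NNReal
open Summit.HodgeConjecture.HodgeConjecture.Cruxes.H413.K2E3GL3OneLinkNestedHighKill (false_of_constituent_X_two)
open Summit.HodgeConjecture.HodgeConjecture.Cruxes.H413.K2E3GL3OneLinkNestedHighConstituent (exists_constituent_X_two)
open Summit.HodgeConjecture.HodgeConjecture.Cruxes.H413.K2E3DegenerateSubquotientHeredity (forall_mk_whittakerTwist_eq_zero_subquotient forall_mk_charTwist_eq_zero_of_surjective)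

namespace Summit.HodgeConjecture.HodgeConjecture.Cruxes.H413.K2E3GL3OneLinkNestedHighNoPiece

variable {F : Type} [Field F] [ValuativeRel F] [TopologicalSpace F] [IsNonarchimedeanLocalField F] (η : Fˣ →* ℂˣ)

set_option maxHeartbeats 3200000 in  -- cumulative budget of the declaration over large Jacquet-module terms
/-- **NO `{X²}`-PIECE**: a non-zero smooth `ψ`-degenerate subquotient `V` of a smooth `I` carrying the cell hypothesis, with `r_B V` finite-dimensional, constituents with `r_B ≠ 0`,
`mult V X = 2` and no other weight, does not exist. [cite: BernsteinZelevinsky1977, Cor. 2.13, Thm. 2.9, Thm. 4.7] [cite: Zelevinsky1980, §1.6, Ex. 3.2, 4.3] -/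
theorem false_of_piece_X_two (hη : IsOpen ((η.ker : Subgroup Fˣ) : Set Fˣ))
    {XI : Type} [AddCommGroup XI] [Module ℂ XI] (I : Representation ℂ (GL (Fin 3) F) XI) (hI : I.IsSmooth)
    (hcell : ∀ (W : Type) [AddCommGroup W] [Module ℂ W] (σ : Representation ℂ (Π a, GL {i // (![0, 0, 1] : Fin 3 → Fin 2) i = a} F) W),
      σ.IsIrreducible → σ.IsSmooth → σ.IsSupercuspidal → ∀ (N : Subrepresentation (jacquetGL F (![0, 0, 1] : Fin 3 → Fin 2) I)) (q : N.toRepresentation.IntertwiningMap σ), q = 0)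
    {Y : Type} [AddCommGroup Y] [Module ℂ Y] [Nontrivial Y] (V : Representation ℂ (GL (Fin 3) F) Y) (hV : V.IsSmooth)
    [FiniteDimensional ℂ (restrictUnipotentGL F (id : Fin 3 → Fin 3) V).Coinvariants]
    {Y₁ : Type} [AddCommGroup Y₁] [Module ℂ Y₁] (V₁ : Representation ℂ (GL (Fin 3) F) Y₁)
    (ι₁ : V₁.IntertwiningMap I) (hι₁ : Function.Injective ι₁) (π₁ : V₁.IntertwiningMap V) (hπ₁ : Function.Surjective π₁)
    (hJ : ∀ r : SmoothIrrep (GL (Fin 3) F), (IrrClass.mk r).IsConstituentOf V → Nontrivial (restrictUnipotentGL F (id : Fin 3 → Fin 3) r.ρ).Coinvariants)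
    (ψ : AddChar F Circle) (hψ : ψ.IsContinuousNontrivial) (hdeg : ∀ v, Coinvariants.mk (whittakerTwist V ψ) v = 0)
    (hX : finrank ℂ ↥(⨅ m, Module.End.maxGenEigenspace (Representation.normalizedJacquetGL F (id : Fin 3 → Fin 3) V m) ((((∏ a : Fin 3, ((![(η * ((unramifiedTwist F (1 / 2) : QuasiChar F).toMonoidHom)⁻¹), (η * ((unramifiedTwist F (1 / 2) : QuasiChar F).toMonoidHom)), (η * ((unramifiedTwist F (1 / 2) : QuasiChar F).toMonoidHom))] : Fin 3 → (Fˣ →* ℂˣ)) a).comp (Matrix.GeneralLinearGroup.det.comp (Pi.evalMonoidHom (fun a : Fin 3 => GL {i : Fin 3 // (id : Fin 3 → Fin 3) i = a} F) a))) m : ℂˣ) : ℂ))) = 2)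
    (h0 : ∀ ζ : (Π a : Fin 3, GL {i : Fin 3 // (id : Fin 3 → Fin 3) i = a} F) → ℂ, ζ ≠ (fun m : (Π a : Fin 3, GL {i : Fin 3 // (id : Fin 3 → Fin 3) i = a} F) => (((∏ a : Fin 3, ((![(η * ((unramifiedTwist F (1 / 2) : QuasiChar F).toMonoidHom)⁻¹), (η * ((unramifiedTwist F (1 / 2) : QuasiChar F).toMonoidHom)), (η * ((unramifiedTwist F (1 / 2) : QuasiChar F).toMonoidHom))] : Fin 3 → (Fˣ →* ℂˣ)) a).comp (Matrix.GeneralLinearGroup.det.comp (Pi.evalMonoidHom (fun a : Fin 3 => GL {i : Fin 3 // (id : Fin 3 → Fin 3) i = a} F) a))) m : ℂˣ) : ℂ)) → finrank ℂ ↥(⨅ m, Module.End.maxGenEigenspace (Representation.normalizedJacquetGL F (id : Fin 3 → Fin 3) V m) (ζ m)) = 0) : False := by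
  haveI : IsTopologicalRing F := inferInstance
  -- an irreducible constituent `ω = r.ρ` with `E(ω) = {X²}`
  obtain ⟨r, hr, hfd, hXr, h0r⟩ := exists_constituent_X_two η hη V hV hJ hX h0
  haveI := hfd
  -- `r` is a constituent of `I`: a subquotient `N₁ ⁄ N₂` of `I`, up to isomorphism
  have hrI : (IrrClass.mk r).IsConstituentOf I := (hr.of_surjective π₁ hπ₁).of_injective ι₁ hι₁
  obtain ⟨r', hr'r, N₁, N₂, hle, ⟨eqv⟩⟩ := hrI
  obtain ⟨err'⟩ := (IrrClass.mk_eq_mk_iff r' r).1 hr'r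
  let N₂' : Subrepresentation N₁.toRepresentation :=
    ⟨N₂.toSubmodule.comap N₁.toSubmodule.subtype, fun g _ hx => N₂.apply_mem_toSubmodule g hx⟩
  have eqv' : r'.ρ.Equiv N₂'.quotientRep := eqv
  obtain ⟨πr, hπr⟩ : ∃ πr : N₁.toRepresentation.IntertwiningMap r.ρ, Function.Surjective πr := by
    refine ⟨(err'.toIntertwiningMap.comp eqv'.symm.toIntertwiningMap).comp N₂'.mkQ, fun y => ?_⟩
    obtain ⟨x, hx⟩ := N₂'.mkQ_surjective (eqv' (err'.symm y))
    refine ⟨x, ?_⟩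
    rw [Representation.IntertwiningMap.comp_apply, Representation.IntertwiningMap.comp_apply, hx, Representation.Equiv.coe_toIntertwiningMap,
      Representation.Equiv.coe_toIntertwiningMap, Representation.Equiv.symm_apply_apply, Representation.Equiv.apply_symm_apply]
  -- `ψ`-degeneracy descends from `V` to its constituent `r.ρ`
  obtain ⟨r'', hr''r, M₁, M₂, hleM, ⟨eV⟩⟩ := hr
  obtain ⟨err''⟩ := (IrrClass.mk_eq_mk_iff r'' r).1 hr''r
  let M₂' : Subrepresentation M₁.toRepresentation :=
    ⟨M₂.toSubmodule.comap M₁.toSubmodule.subtype, fun g _ hx => M₂.apply_mem_toSubmodule g hx⟩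
  have eV' : r''.ρ.Equiv M₂'.quotientRep := eV
  have hdegM : ∀ x, Coinvariants.mk (whittakerTwist M₂'.quotientRep ψ) x = 0 :=
    fun x => forall_mk_whittakerTwist_eq_zero_subquotient V hV hψ.1 hdeg M₁ M₂' x
  have hdeg'' : ∀ v, Coinvariants.mk (whittakerTwist r''.ρ ψ) v = 0 :=
    forall_mk_charTwist_eq_zero_of_surjective eV'.symm.toIntertwiningMap (EquivLike.surjective eV'.symm) hdegM
  have hdegr : ∀ v, Coinvariants.mk (whittakerTwist r.ρ ψ) v = 0 :=
    forall_mk_charTwist_eq_zero_of_surjective err''.toIntertwiningMap (EquivLike.surjective err'') hdeg''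
  -- (K-c) kills `r.ρ`
  exact false_of_constituent_X_two η hη I N₁.toRepresentation r.ρ hI hcell (Subrepresentation.subtypeIntertwiningMap N₁)
    (Subrepresentation.subtypeIntertwiningMap_injective N₁) πr hπr r.isSmooth hXr h0r ψ hψ hdegr

end Summit.HodgeConjecture.HodgeConjecture.Cruxes.H413.K2E3GL3OneLinkNestedHighNoPiece

end
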